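import Mathlib
import HarnessLib

/-!
# Local factors of a finite algebra over a local ring: rank, length and points

`Literature/RingTheory/Idempotents/FiniteAlgebraLocalFactorsRank.lean`, namespace
`Literature.RingTheory.Idempotents` (companion of `FiniteAlgebraLocalDecomposition.lean`, which produces
the complete orthogonal idempotents `e_I` with LOCAL corners `A ⧸ (1 - e_I)` of a module-finite algebra
`A` over a local ring `(R, 𝔪, κ)` once idempotents lift).  This file is the RANK ∕ LENGTH ∕ POINTS
bookkeeping over such a decomposition, all PROVED, Mathlib only:

* §1 `finrank_eq_length_quotient_mul_length_residueField` — for a LOCAL algebra `B`, finite free over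
  `R` with `R → B` local: `rank_R B = ℓ_B(B ⧸ 𝔪B) · ℓ_{κ(R)}(κ(B))` (Mathlib
  `IsLocalRing.length_restrictScalars` + `IsLocalRing.finrank_quotient_map`); hence
  `ℓ_B(B ⧸ 𝔪B) = rank_R B` when the residue extension is trivial, in particular when `κ(R)` is
  algebraically closed (`length_quotient_eq_finrank_of_isAlgClosed`).
* §2 corners of a complete orthogonal family `e` in a finite free `A` over local `R` are finite free and
  `rank_R A = Σ_i rank_R (A ⧸ (1 - e_i))` (`finrank_eq_sum_finrank_quotient`).
* §3 points with values in an `R`-algebra `Ω` without non-trivial idempotents distribute over the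
  corners: every `f : A →ₐ[R] Ω` has exactly one `i` with `f (e_i) = 1` and factors uniquely through that
  corner (`bijective_sigma_comp_mk`), so `#(A →ₐ[R] Ω) = Σ_i #(A ⧸ (1 - e_i) →ₐ[R] Ω)`.
* §4 `Ω ⊗_R (A ⧸ (1 - e))` is reduced when `Ω ⊗_R A` is; §5 plug-and-play forms for LOCAL corners.

Source: [Stacks Project, Tag 04GG (Lemma 10.153.3 (9)(10): finite algebras over a henselian local ring
are products of local rings) and Tag 02M0 (Lemma 10.52.12: `ℓ_A(M) = Σ_i [κ(𝔪_i) : κ(𝔪)] ℓ_{B_{𝔪_i}}(M_{𝔪_i})`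
for a semi-local `B` over local `A`), Tags 00EC∕00ED (Lemmas 10.21.1–2: idempotents of a ring without
non-trivial idempotents, Spec of a product = disjoint union) and Tag 00NZ (finite flat over local is free)];
§1 is the local case `n = 1`, `M = B ⧸ 𝔪_A B` of 02M0 combined
with `ℓ_A(B ⧸ 𝔪_A B) = dim_κ (B ⧸ 𝔪_A B) = rank_A B`.  Cell `hodgecm-mathlib` FLOOR-0 P5a, (S-γ)∕(γ2-alg)(ii)+(iii): the algebra half of
«reduction of the generic geometric fibre of a finite flat cover = special-fibre 0-cycle with
multiplicities».  THEOREMS ONLY (no definition, no instance, no notation, no named fact, no `sorry`).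
-/

set_option autoImplicit false

namespace Literature.RingTheory.Idempotents

open IsLocalRing Module
open scoped TensorProduct

/-! ### §1 Rank of a finite free local algebra = length of the special fibre × residue degree -/

section LengthRank
variable {R : Type*} [CommRing R] [IsLocalRing R]
variable {B : Type*} [CommRing B] [IsLocalRing B] [Algebra R B]

/-- **`rank_R B = ℓ_B(B ⧸ 𝔪_R B) · ℓ_{κ(R)} κ(B)`** for a local algebra `B`, module-finite and free over
the local ring `R` along a local structure map: the length of the special fibre `B ⧸ 𝔪_R B` over itself,
times the residue degree, is the rank.  (Mathlib `IsLocalRing.length_restrictScalars` for the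
`B`-module `B ⧸ 𝔪_R B`, whose `R`-length is its `κ(R)`-dimension `= rank_R B` by
`IsLocalRing.finrank_quotient_map`.) [cite: StacksProject, Tag 02M0] -/
theorem finrank_eq_length_quotient_mul_length_residueField [IsLocalHom (algebraMap R B)]
    [Module.Finite R B] [Module.Free R B] :
    (Module.finrank R B : ℕ∞) =
      Module.length B (B ⧸ (maximalIdeal R).map (algebraMap R B)) *
        Module.length (ResidueField R) (ResidueField B) := by
  have h1 := IsLocalRing.length_restrictScalars R B (B ⧸ (maximalIdeal R).map (algebraMap R B))
  have h2 : Module.length R (B ⧸ (maximalIdeal R).map (algebraMap R B)) =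
      Module.length (R ⧸ maximalIdeal R) (B ⧸ (maximalIdeal R).map (algebraMap R B)) :=
    Module.length_eq_of_surjective (S := R) (R := R ⧸ maximalIdeal R)
      (M := B ⧸ (maximalIdeal R).map (algebraMap R B)) Ideal.Quotient.mk_surjective
  haveI : Module.Finite (R ⧸ maximalIdeal R) (B ⧸ (maximalIdeal R).map (algebraMap R B)) :=
    Module.Finite.of_restrictScalars_finite R _ _
  letI : Field (R ⧸ maximalIdeal R) := Ideal.Quotient.field (maximalIdeal R)
  rw [h2, Module.length_eq_finrank, IsLocalRing.finrank_quotient_map] at h1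
  exact h1

/-- **`ℓ_B(B ⧸ 𝔪_R B) = rank_R B` when the residue extension has length one** (`κ(R) = κ(B)`).
[cite: StacksProject, Tag 02M0] -/
theorem length_quotient_eq_finrank_of_length_residueField_eq_one [IsLocalHom (algebraMap R B)]
    [Module.Finite R B] [Module.Free R B]
    (h : Module.length (ResidueField R) (ResidueField B) = 1) :
    Module.length B (B ⧸ (maximalIdeal R).map (algebraMap R B)) = Module.finrank R B := by
  have h' := finrank_eq_length_quotient_mul_length_residueField (R := R) (B := B)
  rw [h, mul_one] at h'
  exact h'.symm

/-- Over an algebraically closed residue field `κ(R)` the residue extension of a module-finite local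
algebra along a local map is trivial: `ℓ_{κ(R)} κ(B) = 1` (`κ(B)` is a finite, hence algebraic, field
extension of `κ(R)`; Mathlib `IsAlgClosed.algebraMap_bijective_of_isIntegral`). [folklore] -/
private theorem length_residueField_eq_one_of_isAlgClosed [IsLocalHom (algebraMap R B)] [Module.Finite R B]
    [IsAlgClosed (ResidueField R)] : Module.length (ResidueField R) (ResidueField B) = 1 := by
  haveI : Algebra.IsIntegral (ResidueField R) (ResidueField B) := Algebra.IsIntegral.of_finite _ _
  have hbij := IsAlgClosed.algebraMap_bijective_of_isIntegral (k := ResidueField R)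
    (K := ResidueField B)
  let e : ResidueField R ≃ₗ[ResidueField R] ResidueField B :=
    LinearEquiv.ofBijective (Algebra.linearMap (ResidueField R) (ResidueField B)) hbij
  rw [Module.length_eq_finrank, ← e.finrank_eq, Module.finrank_self, Nat.cast_one]

/-- **`ℓ_B(B ⧸ 𝔪_R B) = rank_R B` over an algebraically closed residue field**: for `B` local,
module-finite free over local `R` with `κ(R)` algebraically closed and `R → B` local, the special fibre
`B ⧸ 𝔪_R B` (an artinian local ring) has length over itself equal to the rank of `B`.  This is the
multiplicity with which the closed point of `Spec B` appears in the specialisation of the generic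
fibre. [cite: StacksProject, Tag 02M0] -/
theorem length_quotient_eq_finrank_of_isAlgClosed [IsLocalHom (algebraMap R B)]
    [Module.Finite R B] [Module.Free R B] [IsAlgClosed (ResidueField R)] :
    Module.length B (B ⧸ (maximalIdeal R).map (algebraMap R B)) = Module.finrank R B :=
  length_quotient_eq_finrank_of_length_residueField_eq_one
    (length_residueField_eq_one_of_isAlgClosed (R := R) (B := B))
end LengthRank

/-! ### §2 Corners of a complete orthogonal family: finite free, rank additive -/

section Corners
variable {R : Type*} [CommRing R]
variable {A : Type*} [CommRing A] [Algebra R A]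

/-- For an idempotent `e` of `A`, the ideal `(1 - e)` is killed by multiplication by `e`. [folklore] -/
private theorem mul_eq_zero_of_mem_span_one_sub {e : A} (he : IsIdempotentElem e) {x : A}
    (hx : x ∈ Ideal.span {1 - e}) : e * x = 0 := by
  obtain ⟨a, rfl⟩ := Ideal.mem_span_singleton'.mp hx
  have : e * (1 - e) = 0 := by rw [mul_sub, mul_one, he.eq, sub_self]
  rw [← mul_assoc, mul_comm e a, mul_assoc, this, mul_zero]

/-- **The corner `A ⧸ (1 - e)` is a direct summand of `A`**: the quotient map has the `R`-linear section
`x̄ ↦ e x`, so the corner is `R`-projective when `A` is. [folklore] -/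
private theorem projective_quotient_span_one_sub [Module.Projective R A] {e : A} (he : IsIdempotentElem e) :
    Module.Projective R (A ⧸ Ideal.span {1 - e}) := by
  let I : Ideal A := Ideal.span {1 - e}
  -- the section, on the quotient by the `R`-submodule underlying `I`
  let i : (A ⧸ I.restrictScalars R) →ₗ[R] A :=
    (I.restrictScalars R).liftQ (LinearMap.mulLeft R e) (by
      intro x hx
      rw [LinearMap.mem_ker, LinearMap.mulLeft_apply]
      exact mul_eq_zero_of_mem_span_one_sub he hx)
  let s : A →ₗ[R] (A ⧸ I.restrictScalars R) := (I.restrictScalars R).mkQ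
  have hsi : s.comp i = LinearMap.id := by
    refine LinearMap.ext fun x => ?_
    obtain ⟨x, rfl⟩ := Submodule.mkQ_surjective (I.restrictScalars R) x
    rw [LinearMap.comp_apply, LinearMap.id_apply]
    change (I.restrictScalars R).mkQ (e * x) = (I.restrictScalars R).mkQ x
    rw [← sub_eq_zero, ← map_sub, Submodule.mkQ_apply, Submodule.Quotient.mk_eq_zero,
      Submodule.restrictScalars_mem]
    refine Ideal.mem_span_singleton'.mpr ⟨-x, ?_⟩
    ring
  haveI : Module.Projective R (A ⧸ I.restrictScalars R) := Module.Projective.of_split i s hsi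
  exact Module.Projective.of_equiv (Submodule.Quotient.restrictScalarsEquiv R I)

/-- **Corners of a finite free algebra over a local ring are free** (projective + finite over a local
ring, Mathlib `Module.free_of_flat_of_isLocalRing`). [cite: StacksProject, Tag 00NZ] -/
theorem free_quotient_span_one_sub [IsLocalRing R] [Module.Finite R A] [Module.Free R A] {e : A}
    (he : IsIdempotentElem e) : Module.Free R (A ⧸ Ideal.span {1 - e}) := by
  haveI := projective_quotient_span_one_sub (R := R) he
  exact Module.free_of_flat_of_isLocalRing

variable {ι : Type*} [Fintype ι] {e : ι → A}

/-- The product of the quotient maps `A → Π_i A ⧸ (1 - e_i)` as an `R`-algebra map is bijective for a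
complete orthogonal family (Mathlib `CompleteOrthogonalIdempotents.bijective_pi`). [folklore] -/
private theorem bijective_piAlgHom_mk (he : CompleteOrthogonalIdempotents e) :
    Function.Bijective (AlgHom.pi fun i => Ideal.Quotient.mkₐ R (Ideal.span {1 - e i})) :=
  he.bijective_pi

/-- **Rank additivity over the corners**: for a complete orthogonal family `e` in a module-finite free
algebra `A` over a local ring `R`, `rank_R A = Σ_i rank_R (A ⧸ (1 - e_i))` (`A ≅ Π_i A ⧸ (1 - e_i)`,
Spec of a product is the disjoint union). [cite: StacksProject, Tag 00ED] -/
theorem finrank_eq_sum_finrank_quotient [IsLocalRing R] [Module.Finite R A] [Module.Free R A]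
    (he : CompleteOrthogonalIdempotents e) :
    Module.finrank R A = ∑ i, Module.finrank R (A ⧸ Ideal.span {1 - e i}) := by
  haveI : ∀ i, Module.Free R (A ⧸ Ideal.span {1 - e i}) :=
    fun i => free_quotient_span_one_sub (R := R) (he.idem i)
  let E : A ≃ₗ[R] (Π i, A ⧸ Ideal.span {1 - e i}) :=
    LinearEquiv.ofBijective
      (AlgHom.pi fun i => Ideal.Quotient.mkₐ R (Ideal.span {1 - e i})).toLinearMap
      (bijective_piAlgHom_mk (R := R) he)
  rw [E.finrank_eq, Module.finrank_pi_fintype]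
end Corners

/-! ### §3 Points with values in a ring without non-trivial idempotents distribute over the corners -/

section Points
variable {R : Type*} [CommRing R]
variable {A : Type*} [CommRing A] [Algebra R A]
variable {ι : Type*} [Fintype ι] {e : ι → A}
variable {Ω : Type*} [CommRing Ω] [Algebra R Ω]

/-- In a non-trivial ring whose only idempotents are `0` and `1`, a complete orthogonal family of
idempotents has EXACTLY ONE member equal to `1` (the others are `0`). [folklore] -/
private theorem existsUnique_eq_one_of_completeOrthogonalIdempotents [Nontrivial Ω]
    (hΩ : ∀ x : Ω, IsIdempotentElem x → x = 0 ∨ x = 1) {u : ι → Ω}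
    (hu : CompleteOrthogonalIdempotents u) : ∃! i, u i = 1 := by
  classical
  have hex : ∃ i, u i = 1 := by
    by_contra h
    have h0 : ∀ i, u i = 0 := fun i =>
      (hΩ (u i) (hu.idem i)).resolve_right fun hi => h ⟨i, hi⟩
    have h1 := hu.complete
    simp only [h0, Finset.sum_const_zero] at h1
    exact zero_ne_one h1
  obtain ⟨i, hi⟩ := hex
  refine ⟨i, hi, fun j hj => ?_⟩
  by_contra hji
  have h := hu.ortho hji
  simp only [hj, hi, mul_one] at h
  exact one_ne_zero h

/-- **The index of a point.**  For a complete orthogonal family `e` in `A` and an `R`-algebra map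
`f : A → Ω` to a non-trivial ring without non-trivial idempotents, there is exactly one `i` with
`f (e_i) = 1` (the images `f (e_i)` are complete orthogonal idempotents of `Ω`; discharge the hypothesis on
`Ω` with Mathlib `IsIdempotentElem.iff_eq_zero_or_one` for domains, or
`IsLocalRing.isUnit_or_isUnit_one_sub_self` for local rings). [cite: StacksProject, Tag 00EC; Tag 00ED] -/
theorem existsUnique_map_eq_one [Nontrivial Ω] (hΩ : ∀ x : Ω, IsIdempotentElem x → x = 0 ∨ x = 1)
    (he : CompleteOrthogonalIdempotents e) (f : A →ₐ[R] Ω) : ∃! i, f (e i) = 1 :=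
  existsUnique_eq_one_of_completeOrthogonalIdempotents hΩ (he.map f.toRingHom)

/-- The idempotent `e` is `1` in the corner `A ⧸ (1 - e)`. [folklore] -/
private theorem mk_span_one_sub_self (x : A) : Ideal.Quotient.mk (Ideal.span {1 - x}) x = 1 := by
  rw [eq_comm, ← map_one (Ideal.Quotient.mk (Ideal.span {1 - x})), Ideal.Quotient.eq]
  exact Ideal.subset_span rfl

/-- A point with `f (e_i) = 1` kills the ideal `(1 - e_i)`. [folklore] -/
private theorem map_eq_zero_of_mem_span_one_sub (f : A →ₐ[R] Ω) {x : A} (hx1 : f x = 1) {y : A}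
    (hy : y ∈ Ideal.span {1 - x}) : f y = 0 := by
  obtain ⟨a, rfl⟩ := Ideal.mem_span_singleton'.mp hy
  rw [map_mul, map_sub, map_one, hx1, sub_self, mul_zero]

/-- … hence factors (uniquely) through the corner `A ⧸ (1 - e_i)`. [folklore] -/
private theorem exists_comp_mk_eq (f : A →ₐ[R] Ω) {x : A} (hx1 : f x = 1) :
    ∃ g : (A ⧸ Ideal.span {1 - x}) →ₐ[R] Ω, g.comp (Ideal.Quotient.mkₐ R (Ideal.span {1 - x})) = f :=
  ⟨Ideal.Quotient.liftₐ (Ideal.span {1 - x}) f (fun _ hy => map_eq_zero_of_mem_span_one_sub f hx1 hy),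
    Ideal.Quotient.liftₐ_comp _ _ _⟩

/-- A map that factors through the corner `A ⧸ (1 - e_i)` takes the value `1` on `e_i`. [folklore] -/
private theorem comp_mk_apply_self_eq_one {x : A} (g : (A ⧸ Ideal.span {1 - x}) →ₐ[R] Ω) :
    (g.comp (Ideal.Quotient.mkₐ R (Ideal.span {1 - x}))) x = 1 := by
  rw [AlgHom.comp_apply, Ideal.Quotient.mkₐ_eq_mk, mk_span_one_sub_self, map_one]

/-- **Points distribute over the corners.**  For a complete orthogonal family `e` in `A` and a
non-trivial `R`-algebra `Ω` without non-trivial idempotents (a field, a domain, a local ring), pulling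
back along the quotient maps is a BIJECTION
`(Σ_i (A ⧸ (1 - e_i) →ₐ[R] Ω)) ≃ (A →ₐ[R] Ω)`: every `Ω`-valued point of `Spec A` lies in exactly one
of the clopen pieces `Spec A ⧸ (1 - e_i)` (Spec of a product is the disjoint union of the Specs).
[cite: StacksProject, Tag 00ED; Tag 00EC] -/
theorem bijective_sigma_comp_mk [Nontrivial Ω] (hΩ : ∀ x : Ω, IsIdempotentElem x → x = 0 ∨ x = 1)
    (he : CompleteOrthogonalIdempotents e) :
    Function.Bijective (fun p : Σ i, ((A ⧸ Ideal.span {1 - e i}) →ₐ[R] Ω) =>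
      p.2.comp (Ideal.Quotient.mkₐ R (Ideal.span {1 - e p.1}))) := by
  classical
  refine ⟨?_, fun f => ?_⟩
  · rintro ⟨i, g⟩ ⟨j, g'⟩ h
    dsimp only at h
    have hi : (g.comp (Ideal.Quotient.mkₐ R (Ideal.span {1 - e i}))) (e i) = 1 :=
      comp_mk_apply_self_eq_one g
    have hj : (g.comp (Ideal.Quotient.mkₐ R (Ideal.span {1 - e i}))) (e j) = 1 := by
      rw [h]; exact comp_mk_apply_self_eq_one g'
    obtain hij : i = j := (existsUnique_map_eq_one hΩ he _).unique hi hj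
    subst hij
    obtain rfl : g = g' := Ideal.Quotient.algHom_ext R h
    rfl
  · obtain ⟨i, hi, -⟩ := existsUnique_map_eq_one hΩ he f
    obtain ⟨g, hg⟩ := exists_comp_mk_eq f hi
    exact ⟨⟨i, g⟩, hg⟩

/-- **`#(A →ₐ[R] Ω) = Σ_i #(A ⧸ (1 - e_i) →ₐ[R] Ω)`** when the corner hom-sets are finite: the number of
`Ω`-points of `Spec A` is the sum over the corners. [cite: StacksProject, Tag 00ED] -/
theorem card_algHom_eq_sum [Nontrivial Ω] (hΩ : ∀ x : Ω, IsIdempotentElem x → x = 0 ∨ x = 1)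
    (he : CompleteOrthogonalIdempotents e) [∀ i, Finite ((A ⧸ Ideal.span {1 - e i}) →ₐ[R] Ω)] :
    Nat.card (A →ₐ[R] Ω) = ∑ i, Nat.card ((A ⧸ Ideal.span {1 - e i}) →ₐ[R] Ω) := by
  rw [← Nat.card_sigma, Nat.card_eq_of_bijective _ (bijective_sigma_comp_mk hΩ he)]

/-- … and in that case `A →ₐ[R] Ω` is finite as well. [cite: StacksProject, Tag 00ED] -/
theorem finite_algHom [Nontrivial Ω] (hΩ : ∀ x : Ω, IsIdempotentElem x → x = 0 ∨ x = 1)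
    (he : CompleteOrthogonalIdempotents e) [∀ i, Finite ((A ⧸ Ideal.span {1 - e i}) →ₐ[R] Ω)] :
    Finite (A →ₐ[R] Ω) :=
  Finite.of_surjective _ (bijective_sigma_comp_mk hΩ he).surjective

omit [Fintype ι] in
/-- **Points of one corner.**  The `Ω`-points of `Spec A` with index `i` (`f (e_i) = 1`) are exactly the
pull-backs of the points of the corner `A ⧸ (1 - e_i)`; as a count,
`#{f : A →ₐ[R] Ω | f (e_i) = 1} = #(A ⧸ (1 - e_i) →ₐ[R] Ω)`. [cite: StacksProject, Tag 00ED] -/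
theorem card_algHom_map_eq_one_eq (i : ι) [Finite ((A ⧸ Ideal.span {1 - e i}) →ₐ[R] Ω)] :
    Nat.card {f : A →ₐ[R] Ω // f (e i) = 1} = Nat.card ((A ⧸ Ideal.span {1 - e i}) →ₐ[R] Ω) := by
  refine (Nat.card_eq_of_bijective
    (fun g : (A ⧸ Ideal.span {1 - e i}) →ₐ[R] Ω =>
      (⟨g.comp (Ideal.Quotient.mkₐ R (Ideal.span {1 - e i})), comp_mk_apply_self_eq_one g⟩ :
        {f : A →ₐ[R] Ω // f (e i) = 1})) ⟨?_, ?_⟩).symm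
  · intro g g' h
    exact Ideal.Quotient.algHom_ext R (congrArg Subtype.val h)
  · rintro ⟨f, hf⟩
    obtain ⟨g, hg⟩ := exists_comp_mk_eq f hf
    exact ⟨g, Subtype.ext hg⟩
end Points

/-! ### §4 Base change of a corner stays reduced («étale generic fibre» passes to the local factors) -/

section Reduced
variable {R : Type*} [CommRing R]
variable {A : Type*} [CommRing A] [Algebra R A]
variable {Ω : Type*} [CommRing Ω] [Algebra R Ω]

/-- A surjection out of a reduced ring whose kernel is generated by `1 - ε`, `ε` idempotent, has reduced
target (the corner `C ⧸ (1 - ε) ≅ εC` sits inside `C`). [folklore] -/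
private theorem isReduced_of_ker_eq_span_one_sub {C D : Type*} [CommRing C] [CommRing D] [IsReduced C]
    {ε : C} (hε : IsIdempotentElem ε) (f : C →+* D) (hf : Function.Surjective f)
    (hker : RingHom.ker f = Ideal.span {1 - ε}) : IsReduced D := by
  refine ⟨fun x hx => ?_⟩
  obtain ⟨n, hn⟩ := hx
  obtain ⟨y, rfl⟩ := hf x
  have hn' : f y ^ (n + 1) = 0 := by rw [pow_succ, hn, zero_mul]
  rw [← map_pow, ← RingHom.mem_ker, hker] at hn'
  have h1 : ε * y ^ (n + 1) = 0 := mul_eq_zero_of_mem_span_one_sub hε hn'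
  have h2 : IsNilpotent (ε * y) := ⟨n + 1, by rw [mul_pow, hε.pow_succ_eq, h1]⟩
  have h3 : ε * y = 0 := h2.eq_zero
  rw [← RingHom.mem_ker, hker]
  refine Ideal.mem_span_singleton'.mpr ⟨y, ?_⟩
  linear_combination -h3

/-- **The base change `Ω ⊗_R (A ⧸ (1 - e))` of a corner is reduced when `Ω ⊗_R A` is**: «the generic
fibre is étale» passes from a finite algebra to each of its local factors (the kernel of
`Ω ⊗ A → Ω ⊗ (A ⧸ (1 - e))` is generated by the idempotent `1 ⊗ (1 - e)`, Mathlib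
`Algebra.TensorProduct.lTensor_ker`). [cite: StacksProject, Tag 00EC; Tag 00ED] -/
theorem isReduced_tensorProduct_quotient_span_one_sub [IsReduced (Ω ⊗[R] A)] {e : A}
    (he : IsIdempotentElem e) : IsReduced (Ω ⊗[R] (A ⧸ Ideal.span {1 - e})) := by
  let g : A →ₐ[R] (A ⧸ Ideal.span {1 - e}) := Ideal.Quotient.mkₐ R _
  have hg : Function.Surjective g := Ideal.Quotient.mkₐ_surjective R _
  let F : Ω ⊗[R] A →ₐ[R] Ω ⊗[R] (A ⧸ Ideal.span {1 - e}) :=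
    Algebra.TensorProduct.map (AlgHom.id R Ω) g
  have hF : Function.Surjective F := by
    intro z
    induction z using TensorProduct.induction_on with
    | zero => exact ⟨0, map_zero F⟩
    | tmul ω b =>
      obtain ⟨a, rfl⟩ := hg b
      exact ⟨ω ⊗ₜ a, Algebra.TensorProduct.map_tmul _ _ _ _⟩
    | add x y hx hy =>
      obtain ⟨x', rfl⟩ := hx
      obtain ⟨y', rfl⟩ := hy
      exact ⟨x' + y', map_add F _ _⟩
  have hε : IsIdempotentElem ((1 : Ω) ⊗ₜ[R] e) := by
    rw [IsIdempotentElem, Algebra.TensorProduct.tmul_mul_tmul, one_mul, he.eq]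
  have hker : RingHom.ker F.toRingHom = Ideal.span {1 - (1 : Ω) ⊗ₜ[R] e} := by
    change RingHom.ker F = _
    have hkg : RingHom.ker g = Ideal.span {1 - e} := Ideal.Quotient.mkₐ_ker R _
    rw [Algebra.TensorProduct.lTensor_ker g hg, hkg, Ideal.map_span, Set.image_singleton]
    congr 2
    rw [Algebra.TensorProduct.includeRight_apply, TensorProduct.tmul_sub, Algebra.TensorProduct.one_def]
  exact isReduced_of_ker_eq_span_one_sub hε F.toRingHom hF hker

/-- The symmetric form: `(A ⧸ (1 - e)) ⊗_R Ω` is reduced when `A ⊗_R Ω` is.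
[cite: StacksProject, Tag 00EC; Tag 00ED] -/
theorem isReduced_quotient_span_one_sub_tensorProduct [IsReduced (A ⊗[R] Ω)] {e : A}
    (he : IsIdempotentElem e) : IsReduced ((A ⧸ Ideal.span {1 - e}) ⊗[R] Ω) := by
  haveI : IsReduced (Ω ⊗[R] A) :=
    isReduced_of_injective _ (Algebra.TensorProduct.comm R Ω A).injective
  haveI := isReduced_tensorProduct_quotient_span_one_sub (R := R) (Ω := Ω) he
  exact isReduced_of_injective _ (Algebra.TensorProduct.comm R (A ⧸ Ideal.span {1 - e}) Ω).injective
end Reduced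

/-! ### §5 Plug-and-play forms for the local corners of `FiniteAlgebraLocalDecomposition` -/

section LocalCorner
variable {R : Type*} [CommRing R] [IsLocalRing R]
variable {C : Type*} [CommRing C] [IsLocalRing C] [Algebra R C]

/-- The structure map of a module-finite LOCAL algebra `C ≠ 0` over a local ring `(R, 𝔪)` is local:
`𝔪C ≠ C` by Nakayama, so `𝔪C ⊆ 𝔪_C`. [cite: StacksProject, Tag 04GG] -/
theorem isLocalHom_algebraMap_of_module_finite [Module.Finite R C] : IsLocalHom (algebraMap R C) := by
  refine ((IsLocalRing.local_hom_TFAE (algebraMap R C)).out 2 0).mp ?_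
  apply IsLocalRing.le_maximalIdeal
  intro htop
  -- Nakayama: `𝔪 • ⊤ = ⊤` forces `C = 0`
  have hsmul : (⊤ : Submodule R C) ≤ maximalIdeal R • ⊤ := by
    rw [Ideal.smul_top_eq_map, htop, Submodule.restrictScalars_top]
  have hbot : (⊤ : Submodule R C) = ⊥ :=
    Submodule.eq_bot_of_le_smul_of_le_jacobson_bot _ ⊤ Module.Finite.fg_top hsmul
      (IsLocalRing.maximalIdeal_le_jacobson _)
  have : (1 : C) = 0 := by
    have h1 : (1 : C) ∈ (⊤ : Submodule R C) := Submodule.mem_top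
    rw [hbot] at h1
    exact (Submodule.mem_bot R).mp h1
  exact one_ne_zero this

/-- **Multiplicity of a local corner = its rank.**  For a module-finite FREE LOCAL algebra `C` over a
local ring `R` with algebraically closed residue field, the special fibre `C ⧸ 𝔪_R C` has length over
itself (= over `C`) equal to `rank_R C`; no local-homomorphism instance needed. [cite: StacksProject, Tag 02M0] -/
theorem length_quotient_eq_finrank_of_isAlgClosed' [Module.Finite R C] [Module.Free R C]
    [IsAlgClosed (ResidueField R)] :
    Module.length C (C ⧸ (maximalIdeal R).map (algebraMap R C)) = Module.finrank R C := by
  haveI := isLocalHom_algebraMap_of_module_finite (R := R) (C := C)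
  exact length_quotient_eq_finrank_of_isAlgClosed

/-- The special fibre of a module-finite free algebra has the rank as its dimension over the residue
field: `dim_{R ⧸ 𝔪} (C ⧸ 𝔪C) = rank_R C` (Mathlib `IsLocalRing.finrank_quotient_map`, restated in the
`(maximalIdeal R).map (algebraMap R C)` currency used here). [cite: StacksProject, Tag 02M0] -/
theorem finrank_quotient_map_maximalIdeal {C : Type*} [CommRing C] [Algebra R C] [Module.Finite R C]
    [Module.Free R C] :
    Module.finrank (R ⧸ maximalIdeal R) (C ⧸ (maximalIdeal R).map (algebraMap R C)) =
      Module.finrank R C :=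
  IsLocalRing.finrank_quotient_map
end LocalCorner

end Literature.RingTheory.Idempotents
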